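import Summits.NavierStokesRegularity.FluidComputer.ClayBlowupZoomTools
import Literature.Analysis.FluidPDE.AncientMildCompactnessForced
import Literature.Analysis.FluidPDE.KNSSMildCompactness
import HarnessLib

/-!
# THE ZOOM WITH FORCE: every Clay blow-up — WITH its Clay force — generates a nontrivial bounded
# ancient mild solution of the UNFORCED Navier–Stokes equations (KNSS 2009, Prop. 6.1, forced)

Cell `ns-blowup`, seat `ns-blowup-ecbridge-2` (g10; the E–C endpoint theory seat). LABEL: E–C typing
(KERNEL — no named fact). WHAT THIS IS NOT: not Navier–Stokes evidence — a necessary STRUCTURE of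
the TYPE `ClayBlowup 1` (no inhabitant is claimed anywhere), hence of every breakdown scenario for
Fefferman's (C) (`navierStokesBreakdownR3_iff_exists_nonempty_clayBlowup`, `ClayBlowup.rescale`).
Companion memo: `run/shared/lean/pub/ns-blowup/ecbridge2/ECBRIDGE-2-MEMO-9.md`.

## Content

Koch–Nadirashvili–Seregin–Šverák 2009, §6: a finite-time singularity of a mild solution generates,
by zooming in on near-maxima — `v⁽ᵏ⁾(y, s) = M_k⁻¹ u(x_k + y/M_k, t_k + s/M_k²)` (6.2) — and the
compactness Lemma 6.1, a bounded ancient mild solution `W` with `|W| ≤ 1 = |W(0, 0)|` (Prop. 6.1).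
Here the blowing-up solution carries a CLAY FORCE `f`, smooth THROUGH the blow-up time: the zoomed
fields solve Navier–Stokes with the force `M_k⁻³ f(t_k + s/M_k², x_k + y/M_k) → 0`, their Oseen
residual is `O(M_k⁻³ · lag)` (`ClayBlowup.exists_zoom_data`, `norm_oseenResidual_smul_stPull_le`), and
the tree's compactness engine WITH VANISHING FORCING (`exists_oseenMild_limit_of_forced_const`, KNSS
Lemma 6.1 with a right-hand side) produces the limit — which solves the UNFORCED Oseen equation:

* **`ClayBlowup.exists_zoom_limit`** (`ν = 1`; any Clay force): near-maximum times `t_k ↑`, points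
  `x_k`, scales `c_k = ‖u(t_k, x_k)‖⁻¹ → 0`, a subsequence `φ` and a field `W` on `(−∞, δ) × ℝ³`,
  `δ > 0` (Leray's forced window past the near-maximum time, uniformly in `k`), such that the zooms
  `c_{φ(j)} u(t_{φ(j)} + c²_{φ(j)} s, x_{φ(j)} + c_{φ(j)} y)` converge to `W(s, ·)` locally uniformly
  at EVERY `s < δ`; `W` is jointly continuous with weakly divergence-free slices, solves the
  UNFORCED Oseen integral equation `W(τ) = e^{(τ−s)Δ}W(s) − B¹_s(W, W)(τ)` for all `s < τ < δ`,
  `|W| ≤ 6` on `(−∞, δ)`, `|W| ≤ 1` on `(−∞, 0]`, `‖W(0, 0)‖ = 1`; it is a KNSS blow-up limit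
  (`IsKNSSBlowupLimit W`: smooth bounded ancient mild solution with `|W| ≤ 1 = sup |W|`) and a
  bounded weak solution on `ℝ³ × (−∞, 0)` in KNSS's sense (`IsBoundedWeakNSSolutionOn`, the input
  class of the tree's Liouville theorems).

THE FORCE DISAPPEARS IN EVERY ZOOM: the singularity mechanism of any (C)-certificate by blow-up is,
at the parabolic scale of its own maxima, an unforced bounded ancient mild solution — the SAME
object as for (A) (KNSS Prop. 6.1). Every Liouville theorem for bounded ancient mild solutions
(KNSS Thms 5.1–5.3; the conjectured general one) therefore constrains forced blow-ups verbatim; the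
companion file `ClayBlowupForcedAxisDecay.lean` reads off KNSS Thm 6.1 WITH THE CLAY FORCE.

References: Koch–Nadirashvili–Seregin–Šverák, Acta Math. 203 (2009), §6 (6.2)–(6.3), Lemma 6.1,
Prop. 6.1 [cite: KochNadirashviliSereginSverak2009, Prop 6.1 and Lemma 6.1]; J. Leray, Acta Math. 63
(1934), (3.16) [cite: Leray1934, (3.16)]; C. L. Fefferman, Clay problem description, (C)
[cite: FeffermanClay2006, (C)].
-/

noncomputable section

namespace Summit.NavierStokesRegularity.FluidComputer

open Set MeasureTheory Filter Topology Function Metric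
open scoped ENNReal NNReal
open Literature.Analysis Literature.Analysis.FluidPDE
open Summit.NavierStokesRegularity.NavierStokesRegularity

namespace ClayBlowup

/-- **THE ZOOM WITH FORCE — KNSS 2009 Prop. 6.1 FOR A CLAY BLOW-UP WITH ITS CLAY FORCE** (`ν = 1`;
no named fact). For every `X : ClayBlowup 1` there are near-maximum times `t_k ∈ (0, T)`, points
`x_k`, scales `c_k = ‖u(t_k, x_k)‖⁻¹ ∈ (0, 1]` with `‖u(t_k, x_k)‖ ≥ k + 1` and
`‖u‖ ≤ (1 + 1/(k+1)) ‖u(t_k, x_k)‖` on `(0, t_k]`, a window `δ > 0` with `t_k + δ c_k² < T`, a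
subsequence `φ` and a field `W : ℝ → ℝ³ → ℝ³` such that: `W` is jointly continuous on
`(−∞, δ) × ℝ³` with weakly divergence-free slices; `W` solves the UNFORCED Oseen equation
`W(τ) = e^{(τ−s)Δ}W(s) − B¹_s(W,W)(τ)` for all `s < τ < δ`; `‖W‖ ≤ 6` on `(−∞, δ)`, `‖W‖ ≤ 1` on
`(−∞, 0]`, `‖W(0, 0)‖ = 1`; `W` is a KNSS blow-up limit (`IsKNSSBlowupLimit`) and a bounded weak
solution on `ℝ³ × (−∞, 0)` (`IsBoundedWeakNSSolutionOn`); and the zooms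
`c_{φ(j)} u(t_{φ(j)} + c_{φ(j)}² s, x_{φ(j)} + c_{φ(j)} y)` converge to `W(s, ·)` locally uniformly in
`y` at every `s < δ`. The forced Oseen residual of the zooms is `O(c_k³)`
(`exists_zoom_data`, `norm_oseenResidual_smul_stPull_le`), so the compactness engine with vanishing
forcing (`exists_oseenMild_limit_of_forced_const`) applies on the slabs shifted by `δ`.
[cite: KochNadirashviliSereginSverak2009, Prop 6.1 and Lemma 6.1 (arXiv p. 11), (6.2)–(6.3)] -/
theorem exists_zoom_limit (X : ClayBlowup 1) :
    ∃ (t : ℕ → ℝ) (x : ℕ → EuclideanSpace ℝ (Fin 3)) (c : ℕ → ℝ) (φ : ℕ → ℕ)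
      (W : ℝ → EuclideanSpace ℝ (Fin 3) → EuclideanSpace ℝ (Fin 3)) (δ : ℝ),
      StrictMono φ ∧ 0 < δ ∧ (∀ k, t k ∈ Ioo 0 X.T) ∧ (∀ k, c k = ‖X.u (t k) (x k)‖⁻¹) ∧
      (∀ k, 0 < c k ∧ c k ≤ 1) ∧ (∀ k : ℕ, (k : ℝ) + 1 ≤ ‖X.u (t k) (x k)‖) ∧
      (∀ k : ℕ, ∀ s ∈ Ioc 0 (t k), ∀ y, ‖X.u s y‖ ≤ (1 + 1 / ((k : ℝ) + 1)) * ‖X.u (t k) (x k)‖) ∧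
      (∀ k, t k + δ * c k ^ 2 < X.T) ∧
      ContinuousOn (uncurry W) (Iio δ ×ˢ univ) ∧
      (∀ s < δ, IsWeaklyDivFree (W s)) ∧
      (∀ s τ : ℝ, s < τ → τ < δ → ∀ y,
        W τ y = UnboundedOperators.heatExtension (W s) (τ - s) y - oseenDuhamel 1 s W W τ y) ∧
      (∀ s < δ, ∀ y, ‖W s y‖ ≤ 6) ∧ (∀ s ≤ 0, ∀ y, ‖W s y‖ ≤ 1) ∧ ‖W 0 0‖ = 1 ∧
      IsKNSSBlowupLimit W ∧
      IsBoundedWeakNSSolutionOn (Iio 0) isOpen_Iio 1 W ∧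
      (∀ s < δ, TendstoLocallyUniformly
        (fun j => (c (φ j) • stPull (c (φ j) ^ 2) (c (φ j)) (t (φ j)) (x (φ j)) X.u) s) (W s) atTop) := by
  have hT := X.T_pos
  obtain ⟨δ, hδ, G, hG0, t, x, hdata⟩ := X.exists_zoom_data
  have ht : ∀ k, t k ∈ Ioo 0 X.T := fun k => (hdata k).1
  have htk : ∀ k, X.T / 2 < t k := fun k => (hdata k).2.1
  have hk1 : ∀ k : ℕ, (k : ℝ) + 1 ≤ ‖X.u (t k) (x k)‖ := fun k => (hdata k).2.2.1
  have hnear : ∀ k : ℕ, ∀ s ∈ Ioc 0 (t k), ∀ y,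
      ‖X.u s y‖ ≤ (1 + 1 / ((k : ℝ) + 1)) * ‖X.u (t k) (x k)‖ := fun k => (hdata k).2.2.2.1
  have hlife : ∀ k, t k + δ / ‖X.u (t k) (x k)‖ ^ 2 < X.T := fun k => (hdata k).2.2.2.2.1
  have h6 : ∀ k, ∀ s ∈ Ioc 0 (t k + δ / ‖X.u (t k) (x k)‖ ^ 2), ∀ y,
      ‖X.u s y‖ ≤ 6 * ‖X.u (t k) (x k)‖ := fun k => (hdata k).2.2.2.2.2.1
  have hres : ∀ k, ∀ s s' : ℝ, 0 ≤ s → s < s' → s' ≤ t k + δ / ‖X.u (t k) (x k)‖ ^ 2 → ∀ y,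
      ‖X.u s' y - UnboundedOperators.heatExtension (X.u s) (1 * (s' - s)) y +
          oseenDuhamel 1 s X.u X.u s' y‖ ≤ (s' - s) * G := fun k => (hdata k).2.2.2.2.2.2
  -- ### magnitudes and scales
  set M : ℕ → ℝ := fun k => ‖X.u (t k) (x k)‖ with hM
  set c : ℕ → ℝ := fun k => (M k)⁻¹ with hc
  have hM1 : ∀ k, 1 ≤ M k := fun k => le_trans (by linarith [k.cast_nonneg (α := ℝ)]) (hk1 k)
  have hM0 : ∀ k, 0 < M k := fun k => lt_of_lt_of_le one_pos (hM1 k)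
  have hc0 : ∀ k, 0 < c k := fun k => inv_pos.2 (hM0 k)
  have hc1 : ∀ k, c k ≤ 1 := fun k => inv_le_one_of_one_le₀ (hM1 k)
  have hcM : ∀ k, c k * M k = 1 := fun k => inv_mul_cancel₀ (hM0 k).ne'
  have hδc : ∀ k, δ / M k ^ 2 = δ * c k ^ 2 := fun k => by
    simp only [hc, inv_pow, div_eq_mul_inv]
  have hcto : Tendsto c atTop (𝓝 0) := by
    have hMto : Tendsto M atTop atTop := by
      refine tendsto_atTop_atTop.2 fun b => ⟨⌈b⌉₊, fun k hk => ?_⟩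
      have h1 : (⌈b⌉₊ : ℝ) ≤ k := by exact_mod_cast hk
      linarith [Nat.le_ceil b, hk1 k]
    exact tendsto_inv_atTop_zero.comp hMto
  -- ### the zoom fields, shifted by `δ`, on the slabs `(A_k, 0)`
  set W₀ : ℕ → ℝ → EuclideanSpace ℝ (Fin 3) → EuclideanSpace ℝ (Fin 3) :=
    fun k => c k • stPull (c k ^ 2) (c k) (t k) (x k) X.u with hW₀
  set w : ℕ → ℝ → EuclideanSpace ℝ (Fin 3) → EuclideanSpace ℝ (Fin 3) :=
    fun k s y => W₀ k (s + δ) y with hw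
  set A : ℕ → ℝ := fun k => -(t k) / c k ^ 2 - δ with hA
  have hw_apply : ∀ k s y, w k s y = c k • X.u (t k + c k ^ 2 * (s + δ)) (x k + c k • y) :=
    fun k s y => rfl
  -- the original times of the shifted zoom
  have horig_pos : ∀ k s, A k < s → 0 < t k + c k ^ 2 * (s + δ) := by
    intro k s hs
    have hc2 : 0 < c k ^ 2 := pow_pos (hc0 k) 2
    have h1 : -(t k) / c k ^ 2 < s + δ := by rw [hA] at hs; linarith
    rw [div_lt_iff₀ hc2] at h1
    linarith
  have horig_lt : ∀ k s, s < 0 → t k + c k ^ 2 * (s + δ) < t k + δ / M k ^ 2 := by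
    intro k s hs
    rw [hδc]
    have hc2 : 0 < c k ^ 2 := pow_pos (hc0 k) 2
    nlinarith
  have horig_le : ∀ k s, s ≤ -δ → t k + c k ^ 2 * (s + δ) ≤ t k := by
    intro k s hs
    have hc2 : 0 < c k ^ 2 := pow_pos (hc0 k) 2
    nlinarith
  -- `A_k → −∞`
  have hAlim : Tendsto A atTop atBot := by
    have hle : ∀ k, A k ≤ -(X.T / 2) * ((k : ℝ) + 1) - δ := by
      intro k
      have hc2 : 0 < c k ^ 2 := pow_pos (hc0 k) 2
      have h1 : -(t k) / c k ^ 2 = -(t k * M k ^ 2) := by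
        rw [hc, inv_pow, div_eq_mul_inv, inv_inv]; ring
      have h2 : X.T / 2 * ((k : ℝ) + 1) ≤ t k * M k ^ 2 := by
        have h3 : (k : ℝ) + 1 ≤ M k ^ 2 := by nlinarith [hk1 k, hM1 k]
        have h4 : X.T / 2 ≤ t k := (htk k).le
        calc X.T / 2 * ((k : ℝ) + 1) ≤ t k * ((k : ℝ) + 1) :=
              mul_le_mul_of_nonneg_right h4 (by positivity)
          _ ≤ t k * M k ^ 2 := mul_le_mul_of_nonneg_left h3 (ht k).1.le
      rw [hA]
      show -(t k) / c k ^ 2 - δ ≤ -(X.T / 2) * ((k : ℝ) + 1) - δ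
      rw [h1]; linarith
    refine tendsto_atBot_mono hle ?_
    have h1 : Tendsto (fun k : ℕ => (k : ℝ) + 1) atTop atTop :=
      tendsto_atTop_add_const_right _ _ tendsto_natCast_atTop_atTop
    have h2 : Tendsto (fun k : ℕ => -(X.T / 2) * ((k : ℝ) + 1)) atTop atBot :=
      h1.const_mul_atTop_of_neg (by linarith)
    exact tendsto_atBot_add_const_right _ _ h2
  -- ### the zooms are classical (forced) solutions on `(A_k, 0)`
  have hcl : ∀ k, ∃ (g : ℝ → EuclideanSpace ℝ (Fin 3) → EuclideanSpace ℝ (Fin 3))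
      (q : ℝ → EuclideanSpace ℝ (Fin 3) → ℝ), IsClassicalNSSolutionOn (Ioo (A k) 0) 1 g (w k) q := by
    intro k
    have h := (X.classical.nsRescale_translate (hc0 k) (t k) (x k)).comp_add_right δ
    refine ⟨_, _, h.mono (fun s hs => ?_) (uniqueDiffOn_Ioo _ _)⟩
    simp only [mem_preimage, mem_Ico]
    exact ⟨(horig_pos k s hs.1).le, (horig_lt k s hs.2).trans (hlife k)⟩
  have hcont : ∀ k, ContinuousOn (uncurry (w k)) (Ioo (A k) 0 ×ˢ univ) := by
    intro k
    obtain ⟨g, q, h⟩ := hcl k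
    exact h.smooth_velocity.continuousOn
  have hdiv : ∀ k, ∀ s ∈ Ioo (A k) 0, IsWeaklyDivFree (w k s) := by
    intro k s hs
    obtain ⟨g, q, h⟩ := hcl k
    exact VectorCalculus.IsDivFree.isWeaklyDivFree_holds (h.divFree s hs)
      (contDiff_infty.1 (h.contDiff_velocity hs) 1)
  -- ### the forced Oseen residual of the zooms
  set Gk : ℕ → ℝ → ℝ → EuclideanSpace ℝ (Fin 3) → EuclideanSpace ℝ (Fin 3) := fun k s τ y =>
    w k τ y - UnboundedOperators.heatExtension (w k s) (τ - s) y + oseenDuhamel 1 s (w k) (w k) τ y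
    with hGk
  have hmild : ∀ k, ∀ s τ : ℝ, A k < s → s < τ → τ < 0 → ∀ y,
      w k τ y = UnboundedOperators.heatExtension (w k s) (τ - s) y -
        oseenDuhamel 1 s (w k) (w k) τ y + Gk k s τ y := by
    intro k s τ _ _ _ y
    simp only [hGk]
    abel
  have hGbound : ∀ k, ∀ s τ : ℝ, A k < s → s < τ → τ < 0 → ∀ y,
      ‖Gk k s τ y‖ ≤ c k ^ 3 * (τ - s) * G := by
    intro k s τ hAs hsτ hτ y
    have e3 : oseenDuhamel 1 s (w k) (w k) τ y = oseenDuhamel 1 (s + δ) (W₀ k) (W₀ k) (τ + δ) y :=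
      oseenDuhamel_translate 1 s δ (W₀ k) (W₀ k) τ y
    have e5 : (τ + δ) - (s + δ) = τ - s := by ring
    show ‖w k τ y - UnboundedOperators.heatExtension (w k s) (τ - s) y +
        oseenDuhamel 1 s (w k) (w k) τ y‖ ≤ _
    rw [e3]
    have hs0 : 0 ≤ t k + c k ^ 2 * (s + δ) := (horig_pos k s hAs).le
    have hss' : t k + c k ^ 2 * (s + δ) < t k + c k ^ 2 * (τ + δ) := by
      have hc2 : 0 < c k ^ 2 := pow_pos (hc0 k) 2
      nlinarith
    have hs' : t k + c k ^ 2 * (τ + δ) ≤ t k + δ / ‖X.u (t k) (x k)‖ ^ 2 := (horig_lt k τ hτ).le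
    have key := norm_oseenResidual_smul_stPull_le (hc0 k) (t k) (x k) X.u (G := G)
      (show s + δ < τ + δ by linarith) y
      (hres k _ _ hs0 hss' hs' (x k + c k • y))
    rw [e5] at key
    exact key
  have hGb : ∀ k, ∀ s τ : ℝ, A k < s → s < τ → τ < 0 → τ - s ≤ 1 → ∀ y,
      ‖Gk k s τ y‖ ≤ G * Real.sqrt (τ - s) := by
    intro k s τ hAs hsτ hτ hlag y
    have h0 : 0 < τ - s := sub_pos.2 hsτ
    have hc3 : c k ^ 3 ≤ 1 := pow_le_one₀ (hc0 k).le (hc1 k)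
    have hsq : τ - s ≤ Real.sqrt (τ - s) := by
      rw [Real.le_sqrt h0.le h0.le]; nlinarith
    calc ‖Gk k s τ y‖ ≤ c k ^ 3 * (τ - s) * G := hGbound k s τ hAs hsτ hτ y
      _ ≤ 1 * (τ - s) * G := by gcongr
      _ ≤ G * Real.sqrt (τ - s) := by rw [one_mul, mul_comm]; gcongr
  have hGlim : ∀ s τ : ℝ, s < τ → τ < 0 → ∀ y, Tendsto (fun k => Gk k s τ y) atTop (𝓝 0) := by
    intro s τ hsτ hτ y
    have hev : ∀ᶠ k in atTop, ‖Gk k s τ y‖ ≤ c k * ((τ - s) * G) := by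
      filter_upwards [hAlim.eventually (eventually_lt_atBot s)] with k hk
      have hc3 : c k ^ 3 ≤ c k := by
        have : c k ^ 2 ≤ 1 := pow_le_one₀ (hc0 k).le (hc1 k)
        nlinarith [hc0 k]
      calc ‖Gk k s τ y‖ ≤ c k ^ 3 * (τ - s) * G := hGbound k s τ hk hsτ hτ y
        _ = c k ^ 3 * ((τ - s) * G) := by ring
        _ ≤ c k * ((τ - s) * G) :=
            mul_le_mul_of_nonneg_right hc3 (mul_nonneg (sub_pos.2 hsτ).le hG0)
    refine squeeze_zero_norm' hev ?_
    simpa using hcto.mul_const ((τ - s) * G)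
  -- ### the uniform bound `‖w_k‖ ≤ 6` on `(A_k, 0)`
  have hbdd : ∀ k, ∀ τ ∈ Ioo (A k) 0, ∀ y, ‖w k τ y‖ ≤ 6 := by
    intro k τ hτ y
    rw [hw_apply, norm_smul, Real.norm_eq_abs, abs_of_pos (hc0 k)]
    have h := h6 k _ ⟨horig_pos k τ hτ.1, (horig_lt k τ hτ.2).le⟩ (x k + c k • y)
    calc c k * ‖X.u (t k + c k ^ 2 * (τ + δ)) (x k + c k • y)‖ ≤ c k * (6 * M k) :=
          mul_le_mul_of_nonneg_left h (hc0 k).le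
      _ = 6 := by rw [← mul_assoc, mul_comm (c k), mul_assoc, hcM]; ring
  -- ### THE ENGINE: KNSS Lemma 6.1 with vanishing forcing
  obtain ⟨φ, V, hφ, hVc, hVdiv, hVbd, hVmild, -, hVpt, hVloc⟩ :=
    exists_oseenMild_limit_of_forced_const hG0 hAlim hcont hdiv hmild hGb hGlim hbdd
  -- ### properties of the limit on `(−∞, 0)` in the shifted time, i.e. `(−∞, δ)`
  have hVcont' : ContinuousOn (uncurry fun s y => V (s + -δ) y) (Iio δ ×ˢ univ) := by
    have hmap : Continuous fun z : ℝ × EuclideanSpace ℝ (Fin 3) => (z.1 + -δ, z.2) :=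
      (continuous_fst.add continuous_const).prodMk continuous_snd
    refine (hVc.comp hmap.continuousOn fun z hz => ⟨?_, mem_univ _⟩)
    have := hz.1; simp only [mem_Iio] at this ⊢; linarith
  have hVmild' : ∀ s τ : ℝ, s < τ → τ < δ → ∀ y,
      V (τ + -δ) y = UnboundedOperators.heatExtension (V (s + -δ)) (τ - s) y -
        oseenDuhamel 1 s (fun σ => V (σ + -δ)) (fun σ => V (σ + -δ)) τ y := by
    intro s τ hsτ hτ y
    rw [oseenDuhamel_translate 1 s (-δ) V V τ y, hVmild (s + -δ) (τ + -δ) (by linarith) (by linarith) y]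
    congr 2
    ring
  -- the near-maximum bound passes to the limit on `(−∞, 0]`
  have hV1 : ∀ s ≤ 0, ∀ y, ‖V (s + -δ) y‖ ≤ 1 := by
    intro s hs y
    have hsδ : s + -δ < 0 := by linarith
    have hpt : Tendsto (fun j => ‖w (φ j) (s + -δ) y‖) atTop (𝓝 ‖V (s + -δ) y‖) :=
      (hVpt (s + -δ) hsδ y).norm
    have hev : ∀ᶠ j in atTop, ‖w (φ j) (s + -δ) y‖ ≤ 1 + 1 / (((φ j : ℕ) : ℝ) + 1) := by
      have hAφ : Tendsto (fun j => A (φ j)) atTop atBot := hAlim.comp hφ.tendsto_atTop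
      filter_upwards [hAφ.eventually (eventually_lt_atBot (s + -δ))] with j hj
      rw [hw_apply, norm_smul, Real.norm_eq_abs, abs_of_pos (hc0 _)]
      have hmem : t (φ j) + c (φ j) ^ 2 * (s + -δ + δ) ∈ Ioc 0 (t (φ j)) :=
        ⟨horig_pos _ _ hj, horig_le _ _ (by linarith)⟩
      have h := hnear (φ j) _ hmem (x (φ j) + c (φ j) • y)
      calc c (φ j) * ‖X.u (t (φ j) + c (φ j) ^ 2 * (s + -δ + δ)) (x (φ j) + c (φ j) • y)‖
          ≤ c (φ j) * ((1 + 1 / (((φ j : ℕ) : ℝ) + 1)) * M (φ j)) :=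
            mul_le_mul_of_nonneg_left h (hc0 _).le
        _ = 1 + 1 / (((φ j : ℕ) : ℝ) + 1) := by
            rw [← mul_assoc, mul_comm (c (φ j)), mul_assoc, hcM, mul_one]
    have hlim : Tendsto (fun j => 1 + 1 / (((φ j : ℕ) : ℝ) + 1)) atTop (𝓝 1) := by
      have h := (tendsto_one_div_add_atTop_nhds_zero_nat (𝕜 := ℝ)).comp hφ.tendsto_atTop
      simpa using h.const_add 1
    exact le_of_tendsto_of_tendsto hpt hlim hev
  -- the vertex value
  have hV0 : ‖V (0 + -δ) 0‖ = 1 := by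
    have hpt : Tendsto (fun j => ‖w (φ j) (0 + -δ) 0‖) atTop (𝓝 ‖V (0 + -δ) 0‖) :=
      (hVpt (0 + -δ) (by linarith) 0).norm
    have hconst : (fun j => ‖w (φ j) (0 + -δ) 0‖) = fun _ => 1 := by
      funext j
      rw [hw_apply, norm_smul, Real.norm_eq_abs, abs_of_pos (hc0 _)]
      simp only [zero_add, neg_add_cancel, mul_zero, add_zero, smul_zero]
      exact hcM (φ j)
    rw [hconst] at hpt
    exact tendsto_nhds_unique hpt tendsto_const_nhds
  -- the limit in KNSS's classes on `(−∞, 0)`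
  have hVcont0 : ContinuousOn (uncurry fun s y => V (s + -δ) y) (Iio 0 ×ˢ univ) :=
    hVcont'.mono (prod_mono (fun s hs => by simp only [mem_Iio] at hs ⊢; linarith) subset_rfl)
  have hVdiv0 : ∀ s < 0, IsWeaklyDivFree ((fun s y => V (s + -δ) y) s) := fun s hs =>
    hVdiv (s + -δ) (by linarith)
  have hVmild0 : ∀ s τ : ℝ, s < τ → τ < 0 → ∀ y,
      (fun s y => V (s + -δ) y) τ y =
        UnboundedOperators.heatExtension ((fun s y => V (s + -δ) y) s) (τ - s) y -
          oseenDuhamel 1 s (fun s y => V (s + -δ) y) (fun s y => V (s + -δ) y) τ y :=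
    fun s τ hsτ hτ y => hVmild' s τ hsτ (hτ.trans hδ) y
  have hVbd0 : ∀ s < 0, ∀ y, ‖(fun s y => V (s + -δ) y) s y‖ ≤ 6 := fun s hs y =>
    hVbd (s + -δ) (by linarith) y
  have hweak : IsBoundedWeakNSSolutionOn (Iio 0) isOpen_Iio 1 (fun s y => V (s + -δ) y) :=
    isBoundedWeakNSSolutionOn_of_oseen one_pos hVcont0 ⟨6, hVbd0⟩ hVdiv0
      (fun s τ hsτ hτ y => by rw [one_mul]; exact hVmild0 s τ hsτ hτ y)
  have hknss : IsKNSSBlowupLimit (fun s y => V (s + -δ) y) := by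
    have hanc : IsBoundedAncientMildSolution 1 (fun s y => V (s + -δ) y) :=
      isBoundedAncientMildSolution_of_oseen one_pos hVcont0 ⟨6, hVbd0⟩ hVdiv0
        (fun s τ hsτ hτ y => by rw [one_mul]; exact hVmild0 s τ hsτ hτ y)
    obtain ⟨hsm, -⟩ := smooth_and_bounds_of_bounded_ancient_oseenMild hVcont0 hVdiv0 hVmild0 hVbd0
    refine ⟨hanc, fun s hs => ?_, by simpa using hsm, fun s hs y => hV1 s hs.le y, fun ε hε => ?_⟩
    · exact (hVcont0.comp_continuous (Continuous.prodMk_right s)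
        fun y => ⟨hs, mem_univ y⟩).aestronglyMeasurable
    · -- near `(0, 0)` the norm exceeds `1 − ε`, by continuity at the vertex
      have hcat : ContinuousAt (uncurry fun s y => V (s + -δ) y) (0, 0) :=
        hVcont'.continuousAt ((isOpen_Iio.prod isOpen_univ).mem_nhds ⟨hδ, mem_univ _⟩)
      have hpath : Tendsto (fun s : ℝ => ((s, (0 : EuclideanSpace ℝ (Fin 3))) : ℝ × _)) (𝓝 0)
          (𝓝 (0, 0)) := Continuous.tendsto (Continuous.prodMk_left 0) 0
      have hlim : Tendsto (fun s : ℝ => ‖V (s + -δ) 0‖) (𝓝 0) (𝓝 ‖V (0 + -δ) 0‖) :=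
        (hcat.tendsto.comp hpath).norm
      rw [hV0] at hlim
      have hev : ∀ᶠ s in 𝓝[<] (0 : ℝ), 1 - ε < ‖V (s + -δ) 0‖ ∧ s < 0 :=
        ((hlim.eventually (lt_mem_nhds (by linarith))).filter_mono nhdsWithin_le_nhds).and
          self_mem_nhdsWithin
      obtain ⟨s, hs1, hs0⟩ := hev.exists
      exact ⟨s, hs0, 0, hs1⟩
  -- ### assemble
  refine ⟨t, x, c, φ, fun s y => V (s + -δ) y, δ, hφ, hδ, ht, fun k => rfl, fun k => ⟨hc0 k, hc1 k⟩,
    hk1, hnear, fun k => ?_, hVcont', fun s hs => hVdiv (s + -δ) (by linarith), hVmild',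
    fun s hs y => hVbd (s + -δ) (by linarith) y, hV1, hV0, hknss, hweak, fun s hs => ?_⟩
  · rw [← hδc]; exact hlife k
  · have h := hVloc (s + -δ) (by linarith)
    have e : (fun j => w (φ j) (s + -δ)) =
        fun j => (c (φ j) • stPull (c (φ j) ^ 2) (c (φ j)) (t (φ j)) (x (φ j)) X.u) s := by
      funext j y
      rw [hw_apply, neg_add_cancel_right]
      rfl
    rw [e] at h
    exact h

end ClayBlowup

end Summit.NavierStokesRegularity.FluidComputer

end
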